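import Summits.AtomisticToContinuum.HydrodynamicLimit.Theorems.OneFlightGossipEngineClampedCurrentsDockCutoff
import Literature.Probability.Distributions.GaussianCoordinateMoments
import HarnessLib

/-!
# Gaussian preliminaries for the signed band truncation (helper file A of stub
# `stub_bandShiftStatics`, line `IdeatorOneSketch`, crux `HydroLimitInBand`,
# stmt-AtomisticToContinuum-9133)

Static Gaussian facts on `ℝ³` under the standard Gaussian `γ` behind the re-orthogonalised band
truncation of the suprathermal heat-flux remainder `(b·w)(|w|² − 5θ − G(x,|w|²))`
(`…BandShiftStatics.lean`):

* Wick at order four: `E[ξ₀² ‖ξ‖²] = 5`, so the TRUE fast heat-flux profile `s ↦ s − 5θ` has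
  vanishing radial moment `E[ξ₀² (θ‖ξ‖² − 5θ)] = 0`;
* momentum orthogonality of an odd member `(b·w) Gx(|w|²) ⊥ v_k` under `M_{1,u,θ}` is the scalar
  identity `b_k E[ξ₀² Gx(θ‖ξ‖²)] = 0`; hence for a cut-off profile `G` with `(b·w)G ⊥ v_k` the
  remainder profile `R = s − 5θ − G` satisfies `‖b‖ · E[ξ₀² R(θ‖ξ‖²)] = 0` (registered helper stub
  `bandShift_normMoment`);
* the Gaussian tail of a truncated cubic moment: if `|ω(s)| ≤ C s` and `ω = 0` below `L ≥ 0`, then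
  `|E[ξ₀² ω(θ‖ξ‖²)]| ≤ C θM (4/a²) E[e^{2a‖ξ‖²}] e^{−aL/θM}` (Fernique's constant `2a`).
-/

noncomputable section

namespace Summit.AtomisticToContinuum.HydrodynamicLimit.Theorems.HydroLimitInBandBandShift

open MeasureTheory Filter Set Topology
open Literature.MathematicalPhysics.KineticTheory Literature.Analysis.FluidPDE Literature.Analysis.FunctionSpaces
open ProbabilityTheory
open Summit.AtomisticToContinuum.HydrodynamicLimit.Theorems.KineticCurrentsWindowLDUniformSketch.ClassTruncation
open Summit.AtomisticToContinuum.HydrodynamicLimit.Theorems.ClampedCurrentsDockCutoff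
open KineticFluxLdDecayTilt (integral_eq_zero_of_odd_stdGaussian)

/-! ## Elementary inequalities -/

/-- Cauchy–Schwarz in coordinates: `|b·w| ≤ ‖b‖ ‖w‖`. [folklore] -/
theorem abs_dot_le (b w : V3) : |∑ j, b j * w j| ≤ ‖b‖ * ‖w‖ := by
  have hin : inner ℝ b w = ∑ j, b j * w j := by simp [PiLp.inner_apply, mul_comm]
  rw [← hin]
  exact abs_real_inner_le_norm _ _

/-- `‖v − u‖² ≤ 2‖v‖² + 2U²` for `‖u‖ ≤ U`. [folklore] -/
theorem norm_sub_sq_le {u : V3} {U : ℝ} (hU : ‖u‖ ≤ U) (v : V3) :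
    ‖v - u‖ ^ 2 ≤ 2 * ‖v‖ ^ 2 + 2 * U ^ 2 := by
  have h3 := norm_sub_le v u
  have h4 : ‖u‖ ^ 2 ≤ U ^ 2 := pow_le_pow_left₀ (norm_nonneg _) hU 2
  nlinarith [norm_nonneg (v - u), norm_nonneg v, norm_nonneg u, sq_nonneg (‖v‖ - ‖u‖)]

/-- `‖v‖² ≤ 2‖v − u‖² + 2U²` for `‖u‖ ≤ U`. [folklore] -/
theorem norm_sq_le_of_sub {u : V3} {U : ℝ} (hU : ‖u‖ ≤ U) (v : V3) :
    ‖v‖ ^ 2 ≤ 2 * ‖v - u‖ ^ 2 + 2 * U ^ 2 := by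
  have h3 : ‖v‖ ≤ ‖v - u‖ + ‖u‖ := by
    have := norm_add_le (v - u) u; rwa [sub_add_cancel] at this
  have h4 : ‖u‖ ^ 2 ≤ U ^ 2 := pow_le_pow_left₀ (norm_nonneg _) hU 2
  nlinarith [norm_nonneg (v - u), norm_nonneg v, norm_nonneg u, sq_nonneg (‖v - u‖ - ‖u‖)]

/-- `x² ≤ (4/a²) e^{a x}` for `x ≥ 0`, `a > 0` (from `1 + y ≤ eʸ`). [folklore] -/
theorem sq_le_exp_mul {a x : ℝ} (ha : 0 < a) (hx : 0 ≤ x) :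
    x ^ 2 ≤ 4 / a ^ 2 * Real.exp (a * x) := by
  have h1 : a * x / 2 + 1 ≤ Real.exp (a * x / 2) := Real.add_one_le_exp _
  have h2 : 0 ≤ a * x / 2 := by positivity
  have h3 : (a * x / 2) ^ 2 ≤ Real.exp (a * x / 2) ^ 2 := pow_le_pow_left₀ h2 (by linarith) 2
  have h4 : Real.exp (a * x / 2) ^ 2 = Real.exp (a * x) := by
    rw [sq, ← Real.exp_add, add_halves]
  calc x ^ 2 = 4 / a ^ 2 * (a * x / 2) ^ 2 := by field_simp; ring
    _ ≤ 4 / a ^ 2 * Real.exp (a * x) := by rw [← h4]; gcongr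

/-! ## Wick: the true heat-flux profile has vanishing radial moment -/

/-- Wick at order four on `ℝ³`: `E[ξ₀² ‖ξ‖²] = 5` (`E‖ξ‖⁴ = 15` by Isserlis' theorem,
and the three diagonal moments `E[ξ_j² ‖ξ‖²]` agree by coordinate swaps). [folklore] -/
theorem integral_coord_sq_mul_norm_sq :
    ∫ ξ, ξ 0 * ξ 0 * ‖ξ‖ ^ 2 ∂stdGaussian V3 = 5 := by
  have hE4 : ∫ ξ, ‖ξ‖ ^ 4 ∂stdGaussian V3 = 15 := by
    rw [Literature.Probability.Distributions.integral_norm_pow_four_stdGaussian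
      (EuclideanSpace.basisFun (Fin 3) ℝ)]
    norm_num
  have h : ∀ ξ : V3, ‖ξ‖ ^ 4 = ∑ j, ξ j * ξ j * ‖ξ‖ ^ 2 := by
    intro ξ
    rw [← Finset.sum_mul, show ‖ξ‖ ^ 4 = ‖ξ‖ ^ 2 * ‖ξ‖ ^ 2 by ring]
    congr 1
    rw [EuclideanSpace.real_norm_sq_eq]
    exact Finset.sum_congr rfl fun j _ => sq (ξ j)
  have hint : ∀ j : Fin 3, Integrable (fun ξ : V3 => ξ j * ξ j * ‖ξ‖ ^ 2) (stdGaussian V3) :=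
    fun j => integrable_coord_mul_weight j j (ω := fun s => s) (by fun_prop) (P := 1)
      fun s hs => by rw [abs_of_nonneg hs]; linarith
  have hd : ∀ j : Fin 3, ∫ ξ, ξ j * ξ j * ‖ξ‖ ^ 2 ∂stdGaussian V3 =
      ∫ ξ, ξ 0 * ξ 0 * ‖ξ‖ ^ 2 ∂stdGaussian V3 := fun j => integral_diag_eq j (fun s => s)
  simp_rw [h] at hE4
  rw [integral_finsetSum _ fun j _ => hint j, Fin.sum_univ_three, hd 1, hd 2] at hE4
  linarith

/-- The TRUE fast heat-flux profile `s ↦ s − 5t` has vanishing radial moment in the reduced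
variable: `E[ξ₀² (t‖ξ‖² − 5t)] = t (E[ξ₀²‖ξ‖²] − 5 E[ξ₀²]) = 0`. [folklore] -/
theorem integral_coord_sq_trueFlux (t : ℝ) :
    ∫ ξ, ξ 0 * ξ 0 * (t * ‖ξ‖ ^ 2 - 5 * t) ∂stdGaussian V3 = 0 := by
  have h1 : ∫ ξ : V3, ξ 0 * ξ 0 ∂stdGaussian V3 = 1 := by
    simpa [sq] using integral_coord_sq_stdGaussian (ι := Fin 3) 0
  have hi1 : Integrable (fun ξ : V3 => ξ 0 * ξ 0 * ‖ξ‖ ^ 2) (stdGaussian V3) :=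
    integrable_coord_mul_weight 0 0 (ω := fun s => s) (by fun_prop) (P := 1)
      fun s hs => by rw [abs_of_nonneg hs]; linarith
  have hi0 : Integrable (fun ξ : V3 => ξ 0 * ξ 0) (stdGaussian V3) := by
    simpa using integrable_coord_mul_weight 0 0 (ω := fun _ => (1 : ℝ)) continuous_const (P := 1)
      fun s hs => by rw [abs_one]; linarith
  have e : ∀ ξ : V3, ξ 0 * ξ 0 * (t * ‖ξ‖ ^ 2 - 5 * t) =
      t * (ξ 0 * ξ 0 * ‖ξ‖ ^ 2) - 5 * t * (ξ 0 * ξ 0) := fun ξ => by ring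
  simp_rw [e]
  rw [integral_sub (hi1.const_mul _) (hi0.const_mul _), integral_const_mul, integral_const_mul,
    integral_coord_sq_mul_norm_sq, h1]
  ring

/-! ## Momentum orthogonality of an odd member is one scalar identity -/

/-- If the odd member `(b·w) Gx(|w|²)`, `w = v − u`, is orthogonal to `v_k` under `M_{1,u,θ}`
(`Gx` continuous and bounded on `s ≥ 0`), then `b_k · E[ξ₀² Gx(θ‖ξ‖²)] = 0`: in the reduced
variable `v = u + √θ ξ` the `u_k`-part is odd and the `ξ_k`-part is `θ b_k E[ξ₀² Gx(θ‖ξ‖²)]`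
(`integral_lin_mul_coord_weight`). [folklore] -/
theorem coord_mul_moment_eq_zero {θ : ℝ} (hθ : 0 < θ) (u b : V3) {Gx : ℝ → ℝ}
    (hGc : Continuous Gx) {C : ℝ} (hC : ∀ s, 0 ≤ s → |Gx s| ≤ C) (k : Fin 3)
    (hk : ∫ v, (∑ j, b j * (v - u) j) * Gx (‖v - u‖ ^ 2) * v k * localMaxwellian 1 θ u v = 0) :
    b k * ∫ ξ, ξ 0 * ξ 0 * Gx (θ * ‖ξ‖ ^ 2) ∂stdGaussian V3 = 0 := by
  have hC0 : 0 ≤ C := (abs_nonneg _).trans (hC 0 le_rfl)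
  have hP : ∀ s, 0 ≤ s → |Gx (θ * s)| ≤ C * (1 + s) := fun s hs =>
    le_mul_one_add (hC _ (mul_nonneg hθ.le hs)) hC0 hs
  rw [integral_mul_localMaxwellian_shift hθ u
    (fun v => (∑ j, b j * (v - u) j) * Gx (‖v - u‖ ^ 2) * v k)] at hk
  simp only [lin_shift hθ.le u b Gx, PiLp.add_apply, PiLp.smul_apply, smul_eq_mul] at hk
  have hsq : Real.sqrt θ * Real.sqrt θ = θ := Real.mul_self_sqrt hθ.le
  have e : ∀ ξ : V3, Real.sqrt θ * (∑ j, b j * ξ j) * Gx (θ * ‖ξ‖ ^ 2) * (u k + Real.sqrt θ * ξ k) =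
      u k * (Real.sqrt θ * (∑ j, b j * ξ j) * Gx (θ * ‖ξ‖ ^ 2)) +
        θ * ((∑ j, b j * ξ j) * ξ k * Gx (θ * ‖ξ‖ ^ 2)) := fun ξ => by
    linear_combination ((∑ j, b j * ξ j) * ξ k * Gx (θ * ‖ξ‖ ^ 2)) * hsq
  simp_rw [e] at hk
  have hi1 : Integrable (fun ξ : V3 => Real.sqrt θ * (∑ j, b j * ξ j) * Gx (θ * ‖ξ‖ ^ 2))
      (stdGaussian V3) :=
    integrable_of_le_cube (by fun_prop) (Real.sqrt θ * ‖b‖ * C) fun ξ =>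
      abs_mul_three_le (le_mul_one_add (le_of_eq (abs_of_nonneg (Real.sqrt_nonneg θ)))
        (Real.sqrt_nonneg θ) (sq_nonneg _)) (abs_lin_le b ξ) (hP _ (sq_nonneg _))
  have hi2 : Integrable (fun ξ : V3 => (∑ j, b j * ξ j) * ξ k * Gx (θ * ‖ξ‖ ^ 2))
      (stdGaussian V3) :=
    integrable_of_le_cube (by fun_prop) (‖b‖ * 1 * C) fun ξ =>
      abs_mul_three_le (abs_lin_le b ξ) (abs_coord_le' ξ k) (hP _ (sq_nonneg _))
  have hodd : ∫ ξ : V3, Real.sqrt θ * (∑ j, b j * ξ j) * Gx (θ * ‖ξ‖ ^ 2) ∂stdGaussian V3 = 0 := by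
    refine integral_eq_zero_of_odd_stdGaussian fun ξ => ?_
    simp only [norm_neg, PiLp.neg_apply, mul_neg, Finset.sum_neg_distrib, neg_mul]
  have hlin : ∫ ξ : V3, (∑ j, b j * ξ j) * ξ k * Gx (θ * ‖ξ‖ ^ 2) ∂stdGaussian V3 =
      b k * ∫ ξ, ξ 0 * ξ 0 * Gx (θ * ‖ξ‖ ^ 2) ∂stdGaussian V3 :=
    integral_lin_mul_coord_weight b k (ω := fun s => Gx (θ * s)) (by fun_prop) hP
  rw [integral_add (hi1.const_mul _) (hi2.const_mul _), integral_const_mul, integral_const_mul,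
    hodd, mul_zero, zero_add, hlin] at hk
  exact (mul_eq_zero.1 hk).resolve_left hθ.ne'

/-- **The remainder profile has vanishing weighted radial moment.** For a continuous cut-off profile
`Gx`, bounded on `s ≥ 0`, with `(b·w) Gx(|w|²) ⊥ v_k` under `M_{1,u,θ}` for every `k`, the remainder
`R(s) = s − 5θ − Gx(s)` of the true heat-flux profile satisfies `‖b‖ · E[ξ₀² R(θ‖ξ‖²)] = 0`
(Wick `E[ξ₀²(θ‖ξ‖² − 5θ)] = 0` and `b_k E[ξ₀² Gx(θ‖ξ‖²)] = 0` summed against `b_k`). [folklore] -/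
theorem norm_mul_fluxMoment_eq_zero {θ : ℝ} (hθ : 0 < θ) (u b : V3) {Gx : ℝ → ℝ}
    (hGc : Continuous Gx) {C : ℝ} (hC : ∀ s, 0 ≤ s → |Gx s| ≤ C)
    (horth : ∀ k, ∫ v, (∑ j, b j * (v - u) j) * Gx (‖v - u‖ ^ 2) * v k *
      localMaxwellian 1 θ u v = 0) :
    ‖b‖ * ∫ ξ, ξ 0 * ξ 0 * (θ * ‖ξ‖ ^ 2 - 5 * θ - Gx (θ * ‖ξ‖ ^ 2)) ∂stdGaussian V3 = 0 := by
  have hC0 : 0 ≤ C := (abs_nonneg _).trans (hC 0 le_rfl)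
  set m : ℝ := ∫ ξ, ξ 0 * ξ 0 * Gx (θ * ‖ξ‖ ^ 2) ∂stdGaussian V3 with hm
  have hk : ∀ k, b k * m = 0 := fun k => coord_mul_moment_eq_zero hθ u b hGc hC k (horth k)
  have hiG : Integrable (fun ξ : V3 => ξ 0 * ξ 0 * Gx (θ * ‖ξ‖ ^ 2)) (stdGaussian V3) :=
    integrable_coord_mul_weight 0 0 (ω := fun s => Gx (θ * s)) (by fun_prop) (P := C)
      fun s hs => le_mul_one_add (hC _ (mul_nonneg hθ.le hs)) hC0 hs
  have hiF : Integrable (fun ξ : V3 => ξ 0 * ξ 0 * (θ * ‖ξ‖ ^ 2 - 5 * θ)) (stdGaussian V3) :=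
    integrable_coord_mul_weight 0 0 (ω := fun s => θ * s - 5 * θ) (by fun_prop) (P := 6 * θ)
      fun s hs => by rw [abs_le]; constructor <;> nlinarith [hθ.le]
  have e : ∀ ξ : V3, ξ 0 * ξ 0 * (θ * ‖ξ‖ ^ 2 - 5 * θ - Gx (θ * ‖ξ‖ ^ 2)) =
      ξ 0 * ξ 0 * (θ * ‖ξ‖ ^ 2 - 5 * θ) - ξ 0 * ξ 0 * Gx (θ * ‖ξ‖ ^ 2) := fun ξ => by ring
  simp_rw [e]
  rw [integral_sub hiF hiG, integral_coord_sq_trueFlux, zero_sub, ← hm, mul_neg, neg_eq_zero]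
  have h2 : ‖b‖ ^ 2 * m = 0 := by
    rw [EuclideanSpace.real_norm_sq_eq, Finset.sum_mul]
    exact Finset.sum_eq_zero fun k _ => by rw [sq, mul_assoc, hk k, mul_zero]
  rcases mul_eq_zero.1 h2 with h | h
  · rw [pow_eq_zero_iff two_ne_zero] at h
    rw [h, zero_mul]
  · rw [h, mul_zero]

/-! ## The Gaussian tail of a truncated cubic moment -/

/-- **Gaussian tail of a truncated cubic moment.** If `|ω(s)| ≤ C s` on `s ≥ 0` and `ω(s) = 0` for
`s ≤ L`, then for `0 < t ≤ θM`,
`|E[ξ₀² ω(t‖ξ‖²)]| ≤ C θM (4/a²) E[e^{2a‖ξ‖²}] e^{−aL/θM}`: on the support `‖ξ‖² ≥ L/θM`, and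
`ξ₀² · C t‖ξ‖² ≤ C θM ‖ξ‖⁴ ≤ C θM (4/a²) e^{a‖ξ‖²} ≤ C θM (4/a²) e^{2a‖ξ‖²} e^{−aL/θM}`. [folklore] -/
theorem tail_moment_bound {a : ℝ} (ha : 0 < a)
    (hexp : Integrable (fun ξ : V3 => Real.exp (2 * a * ‖ξ‖ ^ 2)) (stdGaussian V3))
    {t θM C L : ℝ} (ht : 0 < t) (htM : t ≤ θM) (hC : 0 ≤ C) {ω : ℝ → ℝ}
    (hω : ∀ s, 0 ≤ s → |ω s| ≤ C * s) (hω0 : ∀ s, s ≤ L → ω s = 0) :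
    |∫ ξ, ξ 0 * ξ 0 * ω (t * ‖ξ‖ ^ 2) ∂stdGaussian V3| ≤
      C * θM * (4 / a ^ 2) * (∫ ξ, Real.exp (2 * a * ‖ξ‖ ^ 2) ∂stdGaussian V3) *
        Real.exp (-(a * L / θM)) := by
  have hθM : 0 < θM := ht.trans_le htM
  set E : ℝ := Real.exp (-(a * L / θM)) with hE
  have hpt : ∀ ξ : V3, |ξ 0 * ξ 0 * ω (t * ‖ξ‖ ^ 2)| ≤
      C * θM * (4 / a ^ 2) * E * Real.exp (2 * a * ‖ξ‖ ^ 2) := by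
    intro ξ
    by_cases h : t * ‖ξ‖ ^ 2 ≤ L
    · rw [hω0 _ h, mul_zero, abs_zero]; positivity
    · have hξL : a * L / θM ≤ a * ‖ξ‖ ^ 2 := by
        rw [div_le_iff₀ hθM, mul_assoc]
        refine mul_le_mul_of_nonneg_left ?_ ha.le
        nlinarith [not_le.1 h, sq_nonneg ‖ξ‖]
      have h0 : |ξ 0| ≤ ‖ξ‖ := by
        have := PiLp.norm_apply_le ξ 0
        rwa [Real.norm_eq_abs] at this
      have h1 : |ξ 0 * ξ 0| ≤ ‖ξ‖ ^ 2 := by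
        rw [abs_mul, sq]; exact mul_le_mul h0 h0 (abs_nonneg _) (norm_nonneg _)
      have h2 : |ω (t * ‖ξ‖ ^ 2)| ≤ C * θM * ‖ξ‖ ^ 2 :=
        (hω _ (by positivity)).trans (by rw [mul_assoc]; gcongr)
      have h3 : (‖ξ‖ ^ 2) ^ 2 ≤ 4 / a ^ 2 * Real.exp (a * ‖ξ‖ ^ 2) := sq_le_exp_mul ha (sq_nonneg _)
      have h4 : (1 : ℝ) ≤ Real.exp (a * ‖ξ‖ ^ 2) * E := by
        rw [hE, ← Real.exp_add]
        exact Real.one_le_exp (by linarith)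
      have h5 : Real.exp (a * ‖ξ‖ ^ 2) * (Real.exp (a * ‖ξ‖ ^ 2) * E) =
          E * Real.exp (2 * a * ‖ξ‖ ^ 2) := by
        rw [show 2 * a * ‖ξ‖ ^ 2 = a * ‖ξ‖ ^ 2 + a * ‖ξ‖ ^ 2 by ring, Real.exp_add]; ring
      rw [abs_mul]
      calc |ξ 0 * ξ 0| * |ω (t * ‖ξ‖ ^ 2)| ≤ ‖ξ‖ ^ 2 * (C * θM * ‖ξ‖ ^ 2) :=
            mul_le_mul h1 h2 (abs_nonneg _) (sq_nonneg _)
        _ = C * θM * (‖ξ‖ ^ 2) ^ 2 := by ring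
        _ ≤ C * θM * (4 / a ^ 2 * Real.exp (a * ‖ξ‖ ^ 2)) := by gcongr
        _ ≤ C * θM * (4 / a ^ 2 * Real.exp (a * ‖ξ‖ ^ 2)) * (Real.exp (a * ‖ξ‖ ^ 2) * E) :=
            le_mul_of_one_le_right (by positivity) h4
        _ = C * θM * (4 / a ^ 2) * E * Real.exp (2 * a * ‖ξ‖ ^ 2) := by
            linear_combination (C * θM * (4 / a ^ 2)) * h5
  have h := norm_integral_le_of_norm_le (μ := stdGaussian V3)
    (f := fun ξ : V3 => ξ 0 * ξ 0 * ω (t * ‖ξ‖ ^ 2))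
    (hexp.const_mul (C * θM * (4 / a ^ 2) * E))
    (ae_of_all (stdGaussian V3) fun ξ => by rw [Real.norm_eq_abs]; exact hpt ξ)
  rw [Real.norm_eq_abs, integral_const_mul] at h
  calc _ ≤ _ := h
    _ = _ := by ring

/-! ## The registered helper stub -/

/-- **Registered helper stub `bandShift_normMoment`** (helper file A of `stub_bandShiftStatics`, line
`IdeatorOneSketch`, crux stmt-AtomisticToContinuum-9133): for a continuous cut-off profile `Gx`
bounded on `s ≥ 0` with `(b·w) Gx(|w|²) ⊥ v_k` under `M_{1,u,θ}` for every `k`, the remainder of the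
true heat-flux profile has vanishing weighted radial moment, `‖b‖ · E[ξ₀² (θ‖ξ‖² − 5θ − Gx(θ‖ξ‖²))] = 0`
(`norm_mul_fluxMoment_eq_zero`). [folklore] -/
theorem bandShift_normMoment :
    ∀ (θ : ℝ), 0 < θ → ∀ (u b : V3) (Gx : ℝ → ℝ), Continuous Gx →
      ∀ C : ℝ, (∀ s : ℝ, 0 ≤ s → |Gx s| ≤ C) →
      (∀ k : Fin 3, ∫ v, (∑ j : Fin 3, b j * (v - u) j) * Gx (‖v - u‖ ^ 2) * v k *
        localMaxwellian 1 θ u v = 0) →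
      ‖b‖ * ∫ ξ, ξ 0 * ξ 0 * (θ * ‖ξ‖ ^ 2 - 5 * θ - Gx (θ * ‖ξ‖ ^ 2))
        ∂ProbabilityTheory.stdGaussian V3 = 0 :=
  fun _θ hθ u b _Gx hGc _C hC horth => norm_mul_fluxMoment_eq_zero hθ u b hGc hC horth

end Summit.AtomisticToContinuum.HydrodynamicLimit.Theorems.HydroLimitInBandBandShift

end
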